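import Literature.NumberTheory.Transcendental.TorusZeroEstimate
import Mathlib.Algebra.Module.CharacterModule
import Mathlib.Algebra.MvPolynomial.Equiv
import Mathlib.Algebra.Polynomial.Roots
import Mathlib.Analysis.SpecialFunctions.Complex.Log
import Mathlib.LinearAlgebra.Dimension.Constructions
import Mathlib.LinearAlgebra.LinearIndependent.Basic
import HarnessLib

/-!
# Philippon's zero estimate on `𝔾ₘ^d`: the counting corollary used in practice

Topic `Literature/NumberTheory/Transcendental` (trunk T-TRANSCEND). Sibling proof file of
`TorusZeroEstimate.lean` (named fact `Philippon1986_zeroEstimate_torus`, Nesterenko–Philippon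
(eds.), LNM 1752, Ch. 11, Thm 4.1 for `G = 𝔾ₘ^d`, `W = 0`). In applications (loc. cit., Ch. 14,
proof of Prop. 3.6, p. 254) the obstruction subgroup `H` is used only through two consequences:
`H` lies in a hypersurface `z^λ = 1` with `0 < max |λᵢ| ≤ D`, and `Card((Σ·H)/H) ≤ D^d`; and the
count is exploited by exhibiting many points of `Σ` that are pairwise distinct modulo `H`, which
one checks through `λ`: if `σ·H = σ'·H` then `(σ⁻¹σ')^λ = 1`. We package exactly this interface,
so that users of the fact never handle subtori or quotients:

* `Philippon1986_zeroEstimate_torus.ncard_quotient_le` — `Card((Σ·H_A)/H_A) ≤ D^d` (the factor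
  `D^{d - rank A} ≥ 1` removed; `D ≥ 1` is forced by `λ ≠ 0`, `|λᵢ| ≤ D`);
* `Philippon1986_zeroEstimate_torus.exists_char` — there is `λ ∈ ℤ^d`, `λ ≠ 0`, `|λᵢ| ≤ D`, such
  that every finite `T ⊆ Σ` whose points are pairwise `λ`-separated (`χ_λ(σ⁻¹σ') ≠ 1` for
  `σ ≠ σ'` in `T`) has at most `D^d` elements.

## Proved pieces of the zero estimate itself (towards `Philippon1986_zeroEstimate_torus_holds`)

The printed proof (loc. cit., Ch. 11, pp. 218–220) needs the degree theory of §2 there (Hilbert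
functions; Prop. 2.2, a Bézout-type bound; Prop. 2.3), which neither Mathlib nor this library has.
Proved here: `Torus.mem_of_forall_subtorus_char_eq_one`, `Torus.forall_subtorus_char_eq_one_iff`,
`Torus.subtorus_injective` — duality `ann(H_A) = A` for every `A ≤ ℤ^d` (Ch. 11, §2.1, Example:
`A ↦ H_A` is a bijection), via a character `ℤ^d/A → ℚ/ℤ ↪ ℂˣ`
(`Torus.exists_addCircle_rat_embedding_units`); `Torus.exists_short_mem_of_vanishes` — the
"Moreover" step of Ch. 14, p. 254 (a nonzero `q` of total degree `≤ D` vanishing on `H_A` yields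
`λ ∈ A`, `λ ≠ 0`, `|λᵢ| ≤ D`; Dedekind's independence of characters plus duality);
`Philippon1986_zeroEstimate_torus_one` — the full statement for `d = 1` (root counting).

## References

* Yu. V. Nesterenko, P. Philippon (eds.), *Introduction to Algebraic Independence Theory*,
  LNM 1752, Springer 2001, Ch. 11 Thm 4.1 (p. 218); Ch. 14, proof of Prop. 3.6 (p. 254).
* P. Philippon, *Lemmes de zéros dans les groupes algébriques commutatifs*, Bull. Soc. Math.
  France 114 (1986), 355–383.
-/

noncomputable section

open MvPolynomial

namespace Literature.NumberTheory.Transcendental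

namespace Philippon1986_zeroEstimate_torus

open Torus

/-- From the zero estimate: under its hypotheses there is a saturated subgroup `A ≠ 0` of `ℤ^d` and
`λ ∈ A`, `λ ≠ 0`, `|λᵢ| ≤ D`, with `Card((Σ·H_A)/H_A) ≤ D^d` (the printed bound
`Card · 𝓗(H_A; D) ≤ D^d` read through `𝓗(H_A; D) ≥ 1`; note `D ≥ 1` because `λ ≠ 0`).
[cite: NesterenkoPhilippon2001, Ch. 14 proof of Prop. 3.6 p. 254 ("Card((Σ₀+H)/H)·𝓗(H,D) ≤ 𝓗(G,D) = D^d")] -/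
theorem ncard_quotient_le (h : Philippon1986_zeroEstimate_torus) {d : ℕ} (hd : 1 ≤ d)
    {S : Set (Torus d)} {P : MvPolynomial (Fin d) ℂ} {D : ℕ} (hS : S.Finite)
    (h1 : (1 : Torus d) ∈ S) (hP : P ≠ 0) (hdeg : P.totalDegree ≤ D)
    (hv : ∀ g ∈ prodSet S d, aevalAt P g = 0) :
    ∃ A : AddSubgroup (Fin d → ℤ),
      Set.ncard ((QuotientGroup.mk : Torus d → Torus d ⧸ subtorus A) '' S) ≤ D ^ d ∧
      ∃ a ∈ A, a ≠ 0 ∧ ∀ i, |a i| ≤ (D : ℤ) := by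
  obtain ⟨A, -, -, hcard, a, haA, ha0, habs⟩ := h d hd S P D hS h1 hP hdeg hv
  refine ⟨A, ?_, a, haA, ha0, habs⟩
  -- `D ≥ 1` since `a ≠ 0` has a coordinate with `1 ≤ |a i| ≤ D`.
  have hD : 1 ≤ D := by
    obtain ⟨i, hi⟩ : ∃ i, a i ≠ 0 := Function.ne_iff.mp ha0
    have h1i : (1 : ℤ) ≤ |a i| := Int.one_le_abs hi
    have := h1i.trans (habs i)
    exact_mod_cast this
  have hpow : 1 ≤ D ^ (d - Module.finrank ℤ ↥(AddSubgroup.toIntSubmodule A)) :=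
    Nat.one_le_pow _ _ hD
  calc Set.ncard ((QuotientGroup.mk : Torus d → Torus d ⧸ subtorus A) '' S)
      ≤ Set.ncard ((QuotientGroup.mk : Torus d → Torus d ⧸ subtorus A) '' S) *
          D ^ (d - Module.finrank ℤ ↥(AddSubgroup.toIntSubmodule A)) :=
        Nat.le_mul_of_pos_right _ hpow
    _ ≤ D ^ d := hcard

/-- **The interface used in practice** (Nesterenko–Philippon (eds.) 2001, Ch. 14, p. 254): under
the hypotheses of the zero estimate there is a character `λ ∈ ℤ^d`, `λ ≠ 0`, `max |λᵢ| ≤ D`, such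
that any finite set `T ⊆ Σ` of pairwise `λ`-separated points (`χ_λ(σ⁻¹σ') ≠ 1` for `σ ≠ σ'`) has
at most `D^d` elements. (Indeed `T` injects into `(Σ·H_A)/H_A`: `σH_A = σ'H_A` gives
`σ⁻¹σ' ∈ H_A ⊆ ker χ_λ`.) [cite: NesterenkoPhilippon2001, Ch. 14 proof of Prop. 3.6 p. 254] -/
theorem exists_char (h : Philippon1986_zeroEstimate_torus) {d : ℕ} (hd : 1 ≤ d)
    {S : Set (Torus d)} {P : MvPolynomial (Fin d) ℂ} {D : ℕ} (hS : S.Finite)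
    (h1 : (1 : Torus d) ∈ S) (hP : P ≠ 0) (hdeg : P.totalDegree ≤ D)
    (hv : ∀ g ∈ prodSet S d, aevalAt P g = 0) :
    ∃ a : Fin d → ℤ, a ≠ 0 ∧ (∀ i, |a i| ≤ (D : ℤ)) ∧
      ∀ T : Finset (Torus d), (↑T : Set (Torus d)) ⊆ S →
        (∀ σ ∈ T, ∀ σ' ∈ T, σ ≠ σ' → char a (σ⁻¹ * σ') ≠ 1) → T.card ≤ D ^ d := by
  classical
  obtain ⟨A, hcard, a, haA, ha0, habs⟩ := ncard_quotient_le h hd hS h1 hP hdeg hv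
  refine ⟨a, ha0, habs, fun T hT hsep => ?_⟩
  set mk : Torus d → Torus d ⧸ subtorus A := QuotientGroup.mk with hmk
  have hinj : Set.InjOn mk ↑T := by
    intro σ hσ σ' hσ' hq
    by_contra hne
    have hmem : σ⁻¹ * σ' ∈ subtorus A := QuotientGroup.eq.mp hq
    exact hsep σ hσ σ' hσ' hne (hmem a haA)
  calc T.card = (T.image mk).card := (Finset.card_image_of_injOn hinj).symm
    _ = Set.ncard (↑(T.image mk) : Set (Torus d ⧸ subtorus A)) := (Set.ncard_coe_finset _).symm
    _ ≤ Set.ncard (mk '' S) := by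
        refine Set.ncard_le_ncard ?_ (hS.image mk)
        intro q hq
        rw [Finset.coe_image] at hq
        exact Set.image_mono hT hq
    _ ≤ D ^ d := hcard

end Philippon1986_zeroEstimate_torus

/-! ### Duality `ann(H_A) = A` for subtori of `𝔾ₘ^d` -/

namespace Torus

variable {d : ℕ}

/-- `ℚ/ℤ` embeds in `ℂˣ` (by `q ↦ exp(2πiq)`): there is an injective homomorphism
`AddCircle (1 : ℚ) →+ Additive ℂˣ`. [folklore] -/
theorem exists_addCircle_rat_embedding_units :
    ∃ ι : AddCircle (1 : ℚ) →+ Additive ℂˣ, Function.Injective ι := by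
  -- `q ↦ exp(2πiq)` on `ℚ`
  let e : ℚ →+ Additive ℂˣ :=
    AddMonoidHom.mk'
      (fun q : ℚ => Additive.ofMul
        (Units.mk0 (Complex.exp (2 * Real.pi * Complex.I * (q : ℂ))) (Complex.exp_ne_zero _)))
      (by
        intro q r
        rw [← ofMul_mul]
        congr 1
        ext
        simp only [Units.val_mk0, Units.val_mul, Rat.cast_add, mul_add, Complex.exp_add])
  -- its kernel is `ℤ`
  have he : ∀ q : ℚ, e q = 0 ↔ ∃ n : ℤ, (n : ℚ) = q := by
    intro q
    constructor
    · intro h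
      have h1 : Complex.exp (2 * Real.pi * Complex.I * (q : ℂ)) = 1 := by
        have := congrArg (fun x : Additive ℂˣ => ((Additive.toMul x : ℂˣ) : ℂ)) h
        simpa [e] using this
      obtain ⟨n, hn⟩ := Complex.exp_eq_one_iff.mp h1
      refine ⟨n, ?_⟩
      have h2 : (q : ℂ) = (n : ℂ) := by
        have hne : (2 * Real.pi * Complex.I : ℂ) ≠ 0 := by
          simp [Real.pi_ne_zero, Complex.I_ne_zero]
        have : (2 * Real.pi * Complex.I : ℂ) * (q : ℂ) = (2 * Real.pi * Complex.I) * (n : ℂ) := by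
          rw [hn]; ring
        exact mul_left_cancel₀ hne this
      have h3 : ((n : ℚ) : ℂ) = (q : ℂ) := by rw [h2]; push_cast; rfl
      exact_mod_cast h3
    · rintro ⟨n, rfl⟩
      apply Additive.toMul.injective
      ext
      simp only [e, AddMonoidHom.mk'_apply, toMul_ofMul, Units.val_mk0, toMul_zero,
        Units.val_one, Rat.cast_intCast]
      rw [Complex.exp_eq_one_iff]
      exact ⟨n, by ring⟩
  refine ⟨QuotientAddGroup.lift (AddSubgroup.zmultiples (1 : ℚ)) e ?_, ?_⟩
  · intro x hx
    obtain ⟨n, rfl⟩ := AddSubgroup.mem_zmultiples_iff.mp hx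
    rw [AddMonoidHom.mem_ker, he]
    exact ⟨n, by simp⟩
  · rw [injective_iff_map_eq_zero]
    intro x hx
    induction x using QuotientAddGroup.induction_on with
    | H q =>
      rw [QuotientAddGroup.lift_mk, he] at hx
      obtain ⟨n, rfl⟩ := hx
      exact (QuotientAddGroup.eq_zero_iff _).mpr (AddSubgroup.mem_zmultiples_iff.mpr ⟨n, by simp⟩)

/-- **Duality for subtori**: a character of `𝔾ₘ^d` that is trivial on `H_A` belongs to `A`; with the
tautological converse (`forall_subtorus_char_eq_one_iff`), `A ↦ H_A` is injective
(Nesterenko–Philippon (eds.) 2001, Ch. 11, §2.1, Example: "`A ↦ H_A` establishes a bijection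
between the subgroups of `ℤⁿ` and the algebraic subgroups of `G`"). Proof: a nonzero class of `a`
in `ℤ^d/A` is detected by a character `ℤ^d/A → ℚ/ℤ ↪ ℂˣ`
(`CharacterModule.exists_character_apply_ne_zero_of_ne_zero`,
`exists_addCircle_rat_embedding_units`), which defines a point of `H_A` at which `χ_a ≠ 1`.
[cite: NesterenkoPhilippon2001, Ch. 11 §2.1 Example p. 200] -/
theorem mem_of_forall_subtorus_char_eq_one {A : AddSubgroup (Fin d → ℤ)} {a : Fin d → ℤ}
    (h : ∀ z ∈ subtorus A, char a z = 1) : a ∈ A := by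
  classical
  by_contra ha
  have hne : (QuotientAddGroup.mk' A a) ≠ 0 := by
    rwa [Ne, QuotientAddGroup.mk'_apply, QuotientAddGroup.eq_zero_iff]
  obtain ⟨c, hc⟩ := CharacterModule.exists_character_apply_ne_zero_of_ne_zero hne
  obtain ⟨ι, hι⟩ := exists_addCircle_rat_embedding_units
  set Φ : (Fin d → ℤ) →+ Additive ℂˣ :=
    ι.comp ((c : ((Fin d → ℤ) ⧸ A) →+ AddCircle (1 : ℚ)).comp (QuotientAddGroup.mk' A))
    with hΦ
  set z : Torus d := fun i => Additive.toMul (Φ (Pi.single i 1)) with hz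
  have hsingle : ∀ (b : Fin d → ℤ) (i : Fin d),
      b i • (Pi.single i (1 : ℤ) : Fin d → ℤ) = Pi.single i (b i) := by
    intro b i
    rw [← Pi.single_smul, smul_eq_mul, mul_one]
  have hchar : ∀ b : Fin d → ℤ, char b z = Additive.toMul (Φ b) := by
    intro b
    conv_rhs => rw [← Finset.univ_sum_single b]
    rw [map_sum, toMul_sum, char_apply]
    refine Finset.prod_congr rfl fun i _ => ?_
    rw [← hsingle b i, map_zsmul, toMul_zsmul]
  have hzmem : z ∈ subtorus A := by
    intro b hb
    rw [hchar]
    have : Φ b = 0 := by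
      rw [hΦ, AddMonoidHom.comp_apply, AddMonoidHom.comp_apply, QuotientAddGroup.mk'_apply,
        (QuotientAddGroup.eq_zero_iff b).mpr hb, map_zero, map_zero]
    rw [this, toMul_zero]
  have h1 := h z hzmem
  rw [hchar] at h1
  have h2 : Φ a = 0 := Additive.toMul.injective (by rw [h1, toMul_zero])
  apply hc
  apply hι
  rw [map_zero]
  rw [hΦ] at h2
  exact h2

/-- The annihilator of `H_A` in the character group `ℤ^d` of `𝔾ₘ^d` is exactly `A`. [folklore] -/
theorem forall_subtorus_char_eq_one_iff {A : AddSubgroup (Fin d → ℤ)} {a : Fin d → ℤ} :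
    (∀ z ∈ subtorus A, char a z = 1) ↔ a ∈ A :=
  ⟨mem_of_forall_subtorus_char_eq_one, fun ha _ hz => hz a ha⟩

/-- `H_A ≤ H_B ↔ B ≤ A`: the Galois correspondence between subgroups of `ℤ^d` and subtori is
order-reversing and injective. [folklore] -/
theorem subtorus_le_subtorus_iff {A B : AddSubgroup (Fin d → ℤ)} :
    subtorus A ≤ subtorus B ↔ B ≤ A := by
  constructor
  · intro h b hb
    exact mem_of_forall_subtorus_char_eq_one fun z hz => h hz b hb
  · intro h z hz b hb
    exact hz b (h hb)

/-- `A ↦ H_A` is injective. [cite: NesterenkoPhilippon2001, Ch. 11 §2.1 Example p. 200] -/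
theorem subtorus_injective : Function.Injective (subtorus : AddSubgroup (Fin d → ℤ) → _) := by
  intro A B h
  exact le_antisymm (subtorus_le_subtorus_iff.mp h.ge) (subtorus_le_subtorus_iff.mp h.le)

/-! ### The "Moreover" clause: a short nonzero character in `A` -/

/-- **The supplement used in practice** (Nesterenko–Philippon (eds.) 2001, Ch. 14, proof of
Prop. 3.6, p. 254: "`H` is contained in a hypersurface of equation `X₁^{λ₁}⋯X_d^{λ_d} = 1` where
`0 < max |λᵢ| ≤ D`"): if a nonzero polynomial `q` of total degree `≤ D` vanishes on the subtorus
`H_A`, then `A` contains a nonzero character `λ` with `|λᵢ| ≤ D` for all `i`. Proof: by Dedekind's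
independence of characters (`linearIndependent_monoidHom`) two distinct monomials `z^m`, `z^{m'}`
of `q` coincide on `H_A`, so `λ = m - m'` annihilates `H_A`, hence `λ ∈ A`
(`mem_of_forall_subtorus_char_eq_one`).
[cite: NesterenkoPhilippon2001, Ch. 14 proof of Prop. 3.6 p. 254] -/
theorem exists_short_mem_of_vanishes (A : AddSubgroup (Fin d → ℤ)) {q : MvPolynomial (Fin d) ℂ}
    {D : ℕ} (hq : q ≠ 0) (hdeg : q.totalDegree ≤ D)
    (hv : ∀ z ∈ subtorus A, aevalAt q z = 0) :
    ∃ a ∈ A, a ≠ 0 ∧ ∀ i, |a i| ≤ (D : ℤ) := by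
  classical
  -- the characters `z ↦ z^m` of `H_A`, `m ∈ ℕ^d`, with values in `ℂ`
  let ψ : (Fin d →₀ ℕ) → (↥(subtorus A) →* ℂ) := fun m =>
    { toFun := fun z => ∏ i, ((z.1 i : ℂˣ) : ℂ) ^ (m i)
      map_one' := by simp
      map_mul' := fun z w => by
        simp only [Subgroup.coe_mul, Pi.mul_apply, Units.val_mul, mul_pow,
          Finset.prod_mul_distrib] }
  have hψ : ∀ (m : Fin d →₀ ℕ) (z : ↥(subtorus A)), ψ m z = ∏ i, ((z.1 i : ℂˣ) : ℂ) ^ (m i) :=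
    fun _ _ => rfl
  by_cases hcoll : ∃ m ∈ q.support, ∃ m' ∈ q.support, m ≠ m' ∧ ψ m = ψ m'
  · obtain ⟨m, hm, m', hm', hne, heq⟩ := hcoll
    have hbound : ∀ {n : Fin d →₀ ℕ}, n ∈ q.support → ∀ i, (n i : ℤ) ≤ D := by
      intro n hn i
      have := (monomial_le_degreeOf i hn).trans ((degreeOf_le_totalDegree q i).trans hdeg)
      exact_mod_cast this
    refine ⟨fun i => (m i : ℤ) - (m' i : ℤ), ?_, ?_, ?_⟩
    · apply mem_of_forall_subtorus_char_eq_one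
      intro z hz
      have h1 : (∏ i, ((z i : ℂˣ) : ℂ) ^ (m i)) = ∏ i, ((z i : ℂˣ) : ℂ) ^ (m' i) := by
        have := DFunLike.congr_fun heq ⟨z, hz⟩
        simpa only [hψ] using this
      have h2 : (∏ i, (z i) ^ (m i) : ℂˣ) = ∏ i, (z i) ^ (m' i) := by
        apply Units.val_injective
        simpa [Units.val_pow_eq_pow_val] using h1
      simp only [char_apply, zpow_sub, zpow_natCast]
      rw [Finset.prod_mul_distrib, Finset.prod_inv_distrib, h2, mul_inv_cancel]
    · intro h0
      apply hne
      ext i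
      have := congr_fun h0 i
      simp only [Pi.zero_apply, sub_eq_zero, Nat.cast_inj] at this
      exact this
    · intro i
      have h₁ := hbound hm i
      have h₂ := hbound hm' i
      have h₃ : (0 : ℤ) ≤ m i := Nat.cast_nonneg _
      have h₄ : (0 : ℤ) ≤ m' i := Nat.cast_nonneg _
      rw [abs_sub_le_iff]
      constructor <;> linarith
  · -- no two monomials of `q` coincide on `H_A`: contradiction with Dedekind's lemma
    exfalso
    push Not at hcoll
    have hinj : Function.Injective (fun m : ↥q.support => ψ (m : Fin d →₀ ℕ)) := by
      intro m m' h
      by_contra hne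
      exact hcoll m m.2 m' m'.2 (fun e => hne (Subtype.ext e)) h
    have hLI := (linearIndependent_monoidHom ↥(subtorus A) ℂ).comp _ hinj
    rw [Fintype.linearIndependent_iff] at hLI
    have hsum : ∑ m : ↥q.support, q.coeff m •
        ((fun f : ↥(subtorus A) →* ℂ => (f : ↥(subtorus A) → ℂ)) ∘
          fun m : ↥q.support => ψ (m : Fin d →₀ ℕ)) m = 0 := by
      funext z
      simp only [Finset.sum_apply, Pi.smul_apply, Function.comp_apply, smul_eq_mul,
        Pi.zero_apply, hψ]
      have := hv z.1 z.2
      rw [aevalAt, MvPolynomial.eval_eq'] at this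
      rw [← this]
      exact Finset.sum_coe_sort q.support (fun m => q.coeff m * ∏ i, ((z.1 i : ℂˣ) : ℂ) ^ (m i))
    obtain ⟨m, hm⟩ := MvPolynomial.support_nonempty.mpr hq
    exact (MvPolynomial.mem_support_iff.mp hm) (hLI (fun m => q.coeff m) hsum ⟨m, hm⟩)

end Torus

/-! ### The case `d = 1`: counting roots -/

open Torus in
/-- **Theorem 4.1 for `d = 1`** (the zero estimate on `𝔾ₘ`): a nonzero `P ∈ ℂ[X]` of degree
`≤ D` vanishing on `Σ = Σ(1)` forces `Card Σ ≤ D`; this is the conclusion of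
`Philippon1986_zeroEstimate_torus` for `d = 1` with `A = ℤ` (`H_A = {e}`, rank `1`, `λ = 1`).
[cite: NesterenkoPhilippon2001, Ch. 11 Thm 4.1 p. 218 (d = 1)] -/
theorem Philippon1986_zeroEstimate_torus_one (S : Set (Torus 1)) (P : MvPolynomial (Fin 1) ℂ)
    (D : ℕ) (hS : S.Finite) (h1 : (1 : Torus 1) ∈ S) (hP : P ≠ 0) (hdeg : P.totalDegree ≤ D)
    (hv : ∀ g ∈ prodSet S 1, aevalAt P g = 0) :
    ∃ A : AddSubgroup (Fin 1 → ℤ), A ≠ ⊥ ∧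
      (∀ (k : ℤ) (χ : Fin 1 → ℤ), k ≠ 0 → k • χ ∈ A → χ ∈ A) ∧
      Set.ncard ((QuotientGroup.mk : Torus 1 → Torus 1 ⧸ subtorus A) '' S) *
          D ^ (1 - Module.finrank ℤ ↥(AddSubgroup.toIntSubmodule A)) ≤ D ^ 1 ∧
      ∃ a ∈ A, a ≠ 0 ∧ ∀ i, |a i| ≤ (D : ℤ) := by
  classical
  -- root counting: `Card Σ ≤ D`
  have hSD : S.ncard ≤ D := by
    set p : Polynomial ℂ :=
      Polynomial.map (MvPolynomial.eval (Fin.elim0 : Fin 0 → ℂ)) (finSuccEquiv ℂ 0 P) with hp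
    have hinjeval : Function.Injective (MvPolynomial.eval (Fin.elim0 : Fin 0 → ℂ)) := by
      intro a b h
      have ha := eq_C_of_isEmpty a
      have hb := eq_C_of_isEmpty b
      rw [ha, hb] at h ⊢
      simp only [eval_C] at h
      rw [h]
    have hp0 : p ≠ 0 := by
      rw [hp, Ne, Polynomial.map_eq_zero_iff hinjeval, EmbeddingLike.map_eq_zero_iff]
      exact hP
    have hpdeg : p.natDegree ≤ D :=
      calc p.natDegree ≤ (finSuccEquiv ℂ 0 P).natDegree := Polynomial.natDegree_map_le
        _ = P.degreeOf 0 := natDegree_finSuccEquiv P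
        _ ≤ P.totalDegree := degreeOf_le_totalDegree P 0
        _ ≤ D := hdeg
    have heval : ∀ g : Torus 1, p.eval ((g 0 : ℂˣ) : ℂ) = aevalAt P g := by
      intro g
      have hfun :
          (fun i => ((g i : ℂˣ) : ℂ)) = (Fin.cons ((g 0 : ℂˣ) : ℂ) Fin.elim0 : Fin 1 → ℂ) := by
        funext i
        rw [Fin.fin_one_eq_zero i]
        rfl
      rw [aevalAt, hfun, MvPolynomial.eval_eq_eval_mv_eval', hp]
    have hroots : ∀ g ∈ S, ((g 0 : ℂˣ) : ℂ) ∈ (p.roots.toFinset : Set ℂ) := by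
      intro g hg
      rw [Finset.mem_coe, Multiset.mem_toFinset, Polynomial.mem_roots hp0, Polynomial.IsRoot.def,
        heval]
      exact hv g (subset_prodSet h1 le_rfl hg)
    have hinj : Set.InjOn (fun g : Torus 1 => ((g 0 : ℂˣ) : ℂ)) S := by
      intro g _ g' _ h
      funext i
      rw [Fin.fin_one_eq_zero i]
      exact Units.val_injective h
    calc S.ncard ≤ (p.roots.toFinset : Set ℂ).ncard :=
          Set.ncard_le_ncard_of_injOn _ hroots hinj (Finset.finite_toSet _)
      _ = p.roots.toFinset.card := Set.ncard_coe_finset _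
      _ ≤ Multiset.card p.roots := Multiset.toFinset_card_le _
      _ ≤ p.natDegree := Polynomial.card_roots' p
      _ ≤ D := hpdeg
  have hS1 : 1 ≤ S.ncard := (Set.ncard_pos hS).mpr ⟨1, h1⟩
  have hone : (fun _ => (1 : ℤ) : Fin 1 → ℤ) ≠ 0 := fun h => one_ne_zero (congr_fun h 0)
  refine ⟨⊤, ?_, ?_, ?_, ?_⟩
  · intro h
    have : (fun _ => (1 : ℤ) : Fin 1 → ℤ) ∈ (⊥ : AddSubgroup (Fin 1 → ℤ)) :=
      h ▸ AddSubgroup.mem_top _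
    exact hone ((AddSubgroup.mem_bot).mp this)
  · intro k χ _ _
    exact AddSubgroup.mem_top _
  · have hrank :
        Module.finrank ℤ ↥(AddSubgroup.toIntSubmodule (⊤ : AddSubgroup (Fin 1 → ℤ))) = 1 := by
      rw [map_top, finrank_top, Module.finrank_fin_fun]
    rw [hrank, Nat.sub_self, pow_zero, mul_one, pow_one]
    exact (Set.ncard_image_le hS).trans hSD
  · refine ⟨fun _ => 1, AddSubgroup.mem_top _, hone, fun i => ?_⟩
    simp only [abs_one, Nat.one_le_cast]
    exact hS1.trans hSD

end Literature.NumberTheory.Transcendental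

end
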